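import Mathlib
import Literature.Combinatorics.Optimization.SheraliAdamsGapFromLocalKernels
import Literature.Combinatorics.Optimization.MulticutCorrelations
import Literature.Combinatorics.Optimization.MaxCutGapGraphs
import Literature.Combinatorics.Optimization.MaxCutLpLowerBound
import HarnessLib

/-!
# The Charikar–Makarychev–Makarychev Sherali–Adams gap for MAX-CUT, assembled
# (CMM09 Theorem 5.3 ⇐ the gap graphs)

[topic Combinatorics/Optimization]

Seventh and last file of the formalisation of [CharikarMakarychevMakarychev2009] Theorem 5.3 in
the tree's Sherali–Adams currency (`CharikarMakarychevMakarychev2009_maxCutSA` of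
`MaxCutLpLowerBound.lean`).  The printed proof (p. 11): "Consider a graph `G = (V, E)` with maximum
degree `∆` such that 1. every cut cuts at most `1/2 + ε/6` fraction of all edges; 2. every subgraph
on `k` vertices is `Ω(log(n/k))`-path decomposable. Let `γ = cε²/c_∆`, `r = n^γ`, `k = 2(r + 3)`,
and `µ = c_∆ (log k + log log n)/log n`.  Applying Theorem 5.2 (with metric `ρ^alt_µ`) and
Theorem 3.1, we get that the vector `x_ij = …` is a feasible solution of the Sherali–Adams
relaxation. … the value of this solution is at least `(1 − ε/6)|E|`; the value of the optimal
combinatorial solution is at most `(1/2 + ε/6)|E|`."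

Here the pieces proved in the previous files are put together:

* `SheraliAdamsGapFromLocalKernels.not_SAAchieves_maxCut_of_localCorrelations` (Thm 5.2 + Thm 3.1
  + Lemma 2.1 in Gram form): it remains to produce, for every `T` with `|T| ≤ d`, a positive
  semidefinite matrix on `T` entrywise `η`-close to the target kernel
  `F(u,v) = (−(1−µ))^{d_G(u,v)}·[d_G(u,v) ≤ L]`;
* that matrix is the correlation kernel (`MulticutCorrelations.corr_posSemidef`, Cor. 5.1) of the
  good multicut distribution (`PathDecomposableMulticuts.exists_goodMulticut`, Thm 2.4 = CMM10
  Thm 3.3) of the LOCAL edge set `localEdges E T L` (the edges of `G` inside the ball of radius `L`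
  around `T`; printed: "the subgraph on `B(T, l)`"), whose distances agree with those of `G` up to
  `L` from points of `T` (`edist_localEdges_eq`) and which covers `≤ |T|(∆+1)^L ≤ √n` vertices, so
  that the gap graphs' local path decomposability applies;
* the parameters: `ε₁ = min(ε/2, 1/2)`, `µ = ε₁³/40`, `c' = min(c, 1/(4 log(∆+2)))`,
  `L = ⌊c' log n⌋/9`, `η = (1−µ)^L ≤ e^µ n^{−µc'/9}`, `γ = µc'/18`, and `n` large.

Main results: `maxCutSA_of_gapGraphs : CharikarMakarychevMakarychev2009_gapGraphs →
CharikarMakarychevMakarychev2009_maxCutSA`, the pointwise form `not_SAAchieves_maxCut_of_gapGraph`,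
and — with `CharikarMakarychevMakarychev2009_gapGraphs_holds` — the unconditional DISCHARGE
`CharikarMakarychevMakarychev2009_maxCutSA_holds` (sink file: the fact's own module
`MaxCutLpLowerBound.lean` cannot import this one).  No new facts.

## References

* [CharikarMakarychevMakarychev2009] M. Charikar, K. Makarychev, Y. Makarychev, *Integrality gaps for
  Sherali–Adams relaxations*, STOC 2009, Thm 5.3 and its proof (p. 11), Thm 5.2 (p. 9–10),
  Cor. 5.1 (p. 9).  Held text `paper:doi-10-1145-1536414-1536455`.
* [CharikarMakarychevMakarychev2010] SIAM J. Comput. 39 (2010), Thm 3.3, Lemma 3.6.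
* [KothariMekaRaghavendra2017] Thm 7.4 / Thm 1.3 (the `(c,s)` currency of `SAAchieves`).
-/

noncomputable section

open Finset SimpleGraph Matrix Filter Topology

namespace Literature.Combinatorics.Optimization

namespace Multicut

variable {V : Type*} [Fintype V] [DecidableEq V]

/-! ### Balls and local edge sets -/

open Classical in
/-- The ball of radius `L` around the vertex set `T` in `gr E`. [cite: CharikarMakarychevMakarychev2009, Thm 5.2 proof (p. 10: "the ball B(T, l)")] -/
def ball (E : Finset (Sym2 V)) (T : Finset V) (L : ℕ) : Finset V :=
  univ.filter fun v => ∃ t ∈ T, (gr E).edist t v ≤ L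

open Classical in
/-- The edges of `E` with both endpoints in the ball: the local subgraph on `B(T, L)`.
[cite: CharikarMakarychevMakarychev2009, Thm 5.2 proof (p. 10)] -/
def localEdges (E : Finset (Sym2 V)) (T : Finset V) (L : ℕ) : Finset (Sym2 V) :=
  E.filter fun e => ∀ v ∈ e, v ∈ ball E T L

/-- `localEdges ⊆ E`. [cite: CharikarMakarychevMakarychev2009, Thm 5.2 proof (p. 10)] -/
theorem localEdges_subset (E : Finset (Sym2 V)) (T : Finset V) (L : ℕ) : localEdges E T L ⊆ E :=
  filter_subset _ _

/-- The local edge set covers only ball vertices. [cite: CharikarMakarychevMakarychev2009, Thm 5.2 proof (p. 10)] -/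
theorem supp_localEdges_subset (E : Finset (Sym2 V)) (T : Finset V) (L : ℕ) :
    supp (localEdges E T L) ⊆ ball E T L := by
  intro v hv
  obtain ⟨e, he, hve⟩ := mem_supp.1 hv
  exact (mem_filter.1 he).2 v hve

omit [DecidableEq V] in
/-- Points of `T` are in the ball. [cite: CharikarMakarychevMakarychev2009, Thm 5.2 proof (p. 10)] -/
theorem mem_ball_of_mem {E : Finset (Sym2 V)} {T : Finset V} {L : ℕ} {t : V} (ht : t ∈ T) :
    t ∈ ball E T L := by
  refine mem_filter.2 ⟨mem_univ _, t, ht, ?_⟩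
  rw [SimpleGraph.edist_self]; exact bot_le

/-- **Distances up to `L` from points of `T` are realised inside the ball**: a shortest walk of
length `k ≤ L` from `t ∈ T` stays in `B(T, L)`, so `d_{local}(t, v) = d_G(t, v)`.
[cite: CharikarMakarychevMakarychev2009, Thm 5.2 proof (p. 10) and Thm 2.4(1)] -/
theorem edist_localEdges_eq {E : Finset (Sym2 V)} {T : Finset V} {L : ℕ} {t v : V} (ht : t ∈ T)
    {k : ℕ} (hk : (gr E).edist t v = k) (hkL : k ≤ L) : (gr (localEdges E T L)).edist t v = k := by
  refine le_antisymm ?_ (hk ▸ edist_anti_of_subset (localEdges_subset E T L) t v)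
  obtain ⟨p, hp⟩ := exists_walk_of_edist_eq_coe hk
  -- every vertex of `p` is within distance `k ≤ L` of `t`
  have hball : ∀ x ∈ p.support, x ∈ ball E T L := by
    intro x hx
    refine mem_filter.2 ⟨mem_univ _, t, ht, ?_⟩
    calc (gr E).edist t x ≤ (p.takeUntil x hx).length := edist_le _
      _ ≤ p.length := by exact_mod_cast p.length_takeUntil_le_length hx
      _ ≤ L := by rw [hp]; exact_mod_cast hkL
  -- transfer `p` to the local graph
  have key : ∀ {x y : V} (q : (gr E).Walk x y), (∀ z ∈ q.support, z ∈ ball E T L) →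
      ∃ q' : (gr (localEdges E T L)).Walk x y, q'.length = q.length := by
    intro x y q
    induction q with
    | nil => intro _; exact ⟨Walk.nil, rfl⟩
    | @cons a b c hadj q ih =>
      intro hs
      have ha : a ∈ ball E T L := hs a (by simp)
      have hs' : ∀ z ∈ q.support, z ∈ ball E T L := fun z hz => hs z (by simp [hz])
      have hb : b ∈ ball E T L := hs' b (Walk.start_mem_support q)
      obtain ⟨q', hq'⟩ := ih hs'
      have hadj' : (gr (localEdges E T L)).Adj a b := by
        rw [gr_adj] at hadj ⊢
        refine ⟨mem_filter.2 ⟨hadj.1, fun v hv => ?_⟩, hadj.2⟩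
        rcases Sym2.mem_iff.1 hv with rfl | rfl
        · exact ha
        · exact hb
      exact ⟨Walk.cons hadj' q', by simp [hq']⟩
  obtain ⟨q', hq'⟩ := key p hball
  calc (gr (localEdges E T L)).edist t v ≤ q'.length := edist_le q'
    _ = k := by rw [hq', hp]

/-- Far pairs stay far in the local graph. [cite: CharikarMakarychevMakarychev2009, Thm 2.4(2)] -/
theorem lt_edist_localEdges {E : Finset (Sym2 V)} {T : Finset V} {L : ℕ} {u v : V}
    (h : (L : ℕ∞) < (gr E).edist u v) : (L : ℕ∞) < (gr (localEdges E T L)).edist u v :=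
  lt_of_lt_of_le h (edist_anti_of_subset (localEdges_subset E T L) u v)

/-! ### The size of balls in a graph of maximum degree `∆` -/

/-- The neighbours of `w` in `gr E` inject into the edges at `w` (degree bound used for the ball
size). [cite: CharikarMakarychevMakarychev2009, Thm 5.3 proof (p. 11: "maximum degree ∆")] -/
theorem card_neighbors_le (E : Finset (Sym2 V)) (w : V) :
    (univ.filter fun v => (gr E).Adj w v).card ≤ (E.filter fun e => w ∈ e).card := by
  classical
  refine Finset.card_le_card_of_injOn (fun v => s(w, v)) (fun v hv => ?_) (fun v _ v' _ h => ?_)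
  · have hadj := (mem_filter.1 hv).2
    exact mem_coe.2 (mem_filter.2 ⟨(gr_adj.1 hadj).1, Sym2.mem_mk_left _ _⟩)
  · simpa using (Sym2.congr_right (a := w)).1 h

open Classical in
/-- **Ball growth**: `|B(T, L)| ≤ |T|·(∆+1)^L` when every vertex lies on at most `∆` edges.
[cite: CharikarMakarychevMakarychev2009, Thm 5.3 proof (p. 11: "maximum degree ∆", the ball has `≤ k∆^l` vertices)] -/
theorem card_ball_le (E : Finset (Sym2 V)) {Δ : ℕ} (hΔ : ∀ v : V, (E.filter fun e => v ∈ e).card ≤ Δ)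
    (T : Finset V) : ∀ L : ℕ, (ball E T L).card ≤ T.card * (Δ + 1) ^ L := by
  intro L
  induction L with
  | zero =>
    rw [pow_zero, mul_one]
    refine card_le_card fun v hv => ?_
    obtain ⟨-, t, ht, hd⟩ := mem_filter.1 hv
    have : (gr E).edist t v = 0 := nonpos_iff_eq_zero.1 (by exact_mod_cast hd)
    rw [SimpleGraph.edist_eq_zero_iff] at this
    exact this ▸ ht
  | succ L ih =>
    -- `B(L+1) ⊆ B(L) ∪ N(B(L))`
    have hsub : ball E T (L + 1) ⊆ ball E T L ∪
        (ball E T L).biUnion fun w => univ.filter fun v => (gr E).Adj w v := by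
      intro v hv
      obtain ⟨-, t, ht, hd⟩ := mem_filter.1 hv
      by_cases hL : (gr E).edist t v ≤ L
      · exact mem_union_left _ (mem_filter.2 ⟨mem_univ _, t, ht, hL⟩)
      · -- a shortest walk of length `L+1`; its penultimate vertex is in `B(L)`
        have heq : (gr E).edist t v = (L + 1 : ℕ) := by
          refine le_antisymm (by exact_mod_cast hd) ?_
          rw [not_le] at hL
          exact Order.add_one_le_of_lt (by exact_mod_cast hL)
        obtain ⟨p, hp⟩ := exists_walk_of_edist_eq_coe heq
        have hne : ¬ p.Nil := by
          intro h; have := SimpleGraph.Walk.length_eq_zero_iff.2 h; omega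
        -- split off the last edge: `p = p.dropLast ++ last edge`
        have hadj : (gr E).Adj p.penultimate v := p.adj_penultimate hne
        have hw : p.penultimate ∈ ball E T L := by
          refine mem_filter.2 ⟨mem_univ _, t, ht, ?_⟩
          calc (gr E).edist t p.penultimate ≤ (p.dropLast).length := edist_le _
            _ = L := by
                have := p.length_dropLast
                rw [hp] at this
                exact_mod_cast this
        exact mem_union_right _ (mem_biUnion.2 ⟨p.penultimate, hw, mem_filter.2 ⟨mem_univ _, hadj⟩⟩)
    calc (ball E T (L + 1)).card
        ≤ (ball E T L ∪ (ball E T L).biUnion fun w => univ.filter fun v => (gr E).Adj w v).card :=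
          card_le_card hsub
      _ ≤ (ball E T L).card + ((ball E T L).biUnion fun w => univ.filter fun v => (gr E).Adj w v).card :=
          card_union_le _ _
      _ ≤ (ball E T L).card + ∑ w ∈ ball E T L, (univ.filter fun v => (gr E).Adj w v).card := by
          gcongr; exact card_biUnion_le
      _ ≤ (ball E T L).card + ∑ w ∈ ball E T L, Δ := by
          gcongr with w hw
          exact (card_neighbors_le E w).trans (hΔ w)
      _ = (ball E T L).card * (Δ + 1) := by rw [sum_const, smul_eq_mul]; ring
      _ ≤ T.card * (Δ + 1) ^ L * (Δ + 1) := Nat.mul_le_mul_right _ ih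
      _ = T.card * (Δ + 1) ^ (L + 1) := by rw [pow_succ]; ring

end Multicut

/-! ### The target kernel and the local positive semidefinite approximants -/

section Kernel

open Multicut GaussianSignRounding

variable {n : ℕ}

open Classical in
/-- **The target correlation kernel** `F(u,v) = (−(1−µ))^{d_G(u,v)}·[d_G(u,v) ≤ L]` (the Gram form
of the metric `ρ^alt_µ` of Thm 5.2 truncated at `L`, cf. `SheraliAdamsGapFromLocalKernels`).
[cite: CharikarMakarychevMakarychev2009, Thm 5.2 proof (p. 9–10) and Cor. 5.1 (p. 9)] -/
def cmmTarget (E : Finset (Sym2 (Fin n))) (μ : ℝ) (L : ℕ) : Matrix (Fin n) (Fin n) ℝ := fun u v =>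
  if (gr E).edist u v ≤ (L : ℕ∞) then (-(1 - μ)) ^ (gr E).dist u v else 0

/-- `F` is symmetric. [cite: CharikarMakarychevMakarychev2009, Thm 5.2 proof (p. 9–10)] -/
theorem cmmTarget_symm (E : Finset (Sym2 (Fin n))) (μ : ℝ) (L : ℕ) (u v : Fin n) :
    cmmTarget E μ L u v = cmmTarget E μ L v u := by
  unfold cmmTarget
  rw [SimpleGraph.edist_comm, SimpleGraph.dist_comm]

/-- `F(u,u) = 1`. [cite: CharikarMakarychevMakarychev2009, Thm 5.2 proof (p. 9–10)] -/
theorem cmmTarget_diag (E : Finset (Sym2 (Fin n))) (μ : ℝ) (L : ℕ) (u : Fin n) :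
    cmmTarget E μ L u u = 1 := by
  unfold cmmTarget
  rw [SimpleGraph.edist_self, SimpleGraph.dist_self, pow_zero, if_pos (show (0 : ℕ∞) ≤ L from bot_le)]

/-- On edges `F = −1 + µ` (for `L ≥ 1`). [cite: CharikarMakarychevMakarychev2009, Thm 5.3 proof (p. 11: "ρ^alt_µ(i,j) = 1 − µ/2" for adjacent i, j)] -/
theorem cmmTarget_edge (E : Finset (Sym2 (Fin n))) (μ : ℝ) {L : ℕ} (hL : 1 ≤ L) {u v : Fin n}
    (huv : s(u, v) ∈ E) (hne : u ≠ v) : cmmTarget E μ L u v = -1 + μ := by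
  have hadj : (gr E).Adj u v := gr_adj.2 ⟨huv, hne⟩
  unfold cmmTarget
  rw [SimpleGraph.edist_eq_one_iff_adj.2 hadj, SimpleGraph.dist_eq_one_iff_adj.2 hadj, pow_one,
    if_pos (by exact_mod_cast hL)]
  ring

/-- **The local step of Thm 5.3**: if every sub-edge-set of `E` on `≤ √n` vertices is `l`-path
decomposable, `9L ≤ l`, `(1−µ)^L ≤ 1/2`, and `d(∆+1)^L ≤ √n`, then for every `T` with `|T| ≤ d`
the correlation kernel of the good multicut distribution of the local edge set `localEdges E T L`
is a positive semidefinite matrix on `T` entrywise `(1−µ)^L`-close to `F`.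
[cite: CharikarMakarychevMakarychev2009, Thm 5.3 proof (p. 11) with Cor. 5.1 (p. 9) and Thm 2.4] -/
theorem cmm_hloc (E : Finset (Sym2 (Fin n))) (hloop : ∀ e ∈ E, ¬ e.IsDiag) {Δ : ℕ}
    (hΔ : ∀ v : Fin n, (E.filter fun e => v ∈ e).card ≤ Δ) {μ : ℝ} (hμ0 : 0 ≤ μ) (hμ1 : μ ≤ 1)
    {L l : ℕ} (hq : (1 - μ) ^ L ≤ 1 / 2) (hl : 9 * L ≤ l)
    (hPD : ∀ E' ⊆ E, ((supp E').card : ℝ) ^ 2 ≤ n → PathDecomposable l E')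
    {d : ℕ} (hfit : ((d * (Δ + 1) ^ L : ℕ) : ℝ) ^ 2 ≤ n) :
    ∀ T : Finset (Fin n), T.card ≤ d → ∃ P : Matrix ↥T ↥T ℝ, P.PosSemidef ∧
      ∀ i j : ↥T, |P i j - cmmTarget E μ L i j| ≤ (1 - μ) ^ L := by
  intro T hT
  set ET := localEdges E T L with hET
  -- the local edge set is small, hence path decomposable
  have hcard : ((supp ET).card : ℝ) ^ 2 ≤ n := by
    have h1 : (supp ET).card ≤ d * (Δ + 1) ^ L :=
      (card_le_card (supp_localEdges_subset E T L)).trans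
        ((card_ball_le E hΔ T L).trans (Nat.mul_le_mul_right _ hT))
    refine le_trans ?_ hfit
    have : ((supp ET).card : ℝ) ≤ ((d * (Δ + 1) ^ L : ℕ) : ℝ) := by exact_mod_cast h1
    exact pow_le_pow_left₀ (Nat.cast_nonneg _) this 2
  have hPD' : PathDecomposable l ET := hPD ET (localEdges_subset E T L) hcard
  have hloop' : ∀ e ∈ ET, ¬ e.IsDiag := fun e he => hloop e (localEdges_subset E T L he)
  obtain ⟨p, hG⟩ := exists_goodMulticut hμ0 hμ1 hq hl ET hPD' hloop'
  refine ⟨Matrix.of fun i j : ↥T => corr p ET i.1 j.1, corr_posSemidef hG T, fun i j => ?_⟩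
  simp only [Matrix.of_apply]
  have h1μ : 0 ≤ 1 - μ := by linarith
  by_cases hnear : (gr E).edist i.1 j.1 ≤ (L : ℕ∞)
  · -- near pairs: exact agreement
    obtain ⟨k, hk⟩ := ENat.ne_top_iff_exists.1 (ne_top_of_le_ne_top (ENat.coe_ne_top L) hnear)
    have hkL : k ≤ L := by rw [← hk] at hnear; exact_mod_cast hnear
    have hloc : (gr ET).edist i.1 j.1 = k := edist_localEdges_eq i.2 hk.symm hkL
    have hdist : (gr E).dist i.1 j.1 = k := by
      have hr : (gr E).Reachable i.1 j.1 :=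
        SimpleGraph.edist_ne_top_iff_reachable.1 (by rw [← hk]; exact ENat.coe_ne_top k)
      have := Reachable.coe_dist_eq_edist hr
      rw [← hk] at this
      exact_mod_cast this
    rw [corr_eq_of_edist_le hG hloc hkL, cmmTarget, if_pos hnear, hdist, sub_self, abs_zero]
    exact pow_nonneg h1μ L
  · -- far pairs: `F = 0`, `|corr| ≤ (1−µ)^L`
    rw [cmmTarget, if_neg hnear, sub_zero]
    exact abs_corr_le_of_lt_edist hG (lt_edist_localEdges (not_le.1 hnear))

/-- **Thm 5.3, pointwise form**: a loopless nonempty edge set with maximum degree `∆`, all cuts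
`≤ (1/2 + ε)|E|`, and `l`-path-decomposable sub-edge-sets on `≤ √n` vertices defeats degree-`d`
Sherali–Adams at `(1 − ε, 1/2 + ε)` as soon as the parameters fit:
`0 ≤ µ ≤ 1`, `0 < ε₁ < ε`, `40µ ≤ ε₁³`, `(1−µ)^L ≤ 1/2`, `9L ≤ l`, `2 ≤ d`, `d(1−µ)^L ≤ µ/2`,
`(d(∆+1)^L)² ≤ n`. [cite: CharikarMakarychevMakarychev2009, Thm 5.3 proof (p. 11)] -/
theorem not_SAAchieves_maxCut_of_gapGraph (E : Finset (Sym2 (Fin n))) (hE : E.Nonempty)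
    (hloop : ∀ e ∈ E, ¬ e.IsDiag) {Δ : ℕ} (hΔ : ∀ v : Fin n, (E.filter fun e => v ∈ e).card ≤ Δ)
    {ε : ℝ} (hs : ∀ x : Fin n → Bool, ∑ e ∈ E, cutFn e x ≤ (1 / 2 + ε) * E.card)
    {l : ℕ} (hPD : ∀ E' ⊆ E, ((supp E').card : ℝ) ^ 2 ≤ n → PathDecomposable l E')
    {μ : ℝ} (hμ0 : 0 ≤ μ) (hμ1 : μ ≤ 1) {ε₁ : ℝ} (hε₁ : 0 < ε₁) (hε₁ε : ε₁ < ε)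
    (hμε : 40 * μ ≤ ε₁ ^ 3) {L : ℕ} (hq : (1 - μ) ^ L ≤ 1 / 2) (hl : 9 * L ≤ l) {d : ℕ}
    (hd : 2 ≤ d) (hη : (d : ℝ) * (1 - μ) ^ L ≤ μ / 2) (hfit : ((d * (Δ + 1) ^ L : ℕ) : ℝ) ^ 2 ≤ n) :
    ¬ SAAchieves (n := n) maxCutPreds d (1 - ε) (1 / 2 + ε) := by
  have hL : 1 ≤ L := L_pos hq
  have h1μ : 0 ≤ 1 - μ := by linarith
  exact not_SAAchieves_maxCut_of_localCorrelations E hE hloop hs (cmmTarget E μ L)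
    (cmmTarget_symm E μ L) (cmmTarget_diag E μ L) hμ0 (pow_nonneg h1μ L) hε₁ hμε
    (fun u v huv => by
      have hne : u ≠ v := fun h => hloop _ huv (by subst h; simp)
      rw [cmmTarget_edge E μ hL huv hne])
    hd hη (cmm_hloc E hloop hΔ hμ0 hμ1 hq hl hPD hfit) (by linarith)

end Kernel

/-! ### Parameters and the limit `n → ∞` -/

section Assembly

open Multicut Real

/-- `(1 − µ)^L ≤ e^{µ} · n^{−µc'/9}` for `L = ⌊c' log n⌋/9`, `0 ≤ µ ≤ 1`, `n ≥ 1`.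
[cite: CharikarMakarychevMakarychev2009, Thm 5.3 proof (p. 11: the choice of µ, "(1 + o(1)) c ε²")] -/
theorem one_sub_pow_L_le {μ c' : ℝ} (hμ0 : 0 ≤ μ) (hμ1 : μ ≤ 1) {n : ℕ} (hn : 1 ≤ n) :
    (1 - μ) ^ (⌊c' * Real.log n⌋₊ / 9) ≤ Real.exp μ * (n : ℝ) ^ (-(μ * c' / 9)) := by
  set L := ⌊c' * Real.log n⌋₊ / 9 with hL
  have hn' : (0 : ℝ) < n := by exact_mod_cast hn
  have hlog : 0 ≤ Real.log n := Real.log_nonneg (by exact_mod_cast hn)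
  -- `c' log n ≤ 9L + 9`
  have hLge : c' * Real.log n ≤ 9 * (L : ℝ) + 9 := by
    have h1 : c' * Real.log n < (⌊c' * Real.log n⌋₊ : ℝ) + 1 := Nat.lt_floor_add_one _
    have h2 : ⌊c' * Real.log n⌋₊ ≤ 9 * L + 8 := by rw [hL]; omega
    have h3 : (⌊c' * Real.log n⌋₊ : ℝ) ≤ 9 * (L : ℝ) + 8 := by exact_mod_cast h2
    linarith
  calc (1 - μ) ^ L ≤ Real.exp (-μ) ^ L := by
        refine pow_le_pow_left₀ (by linarith) ?_ L
        have := Real.add_one_le_exp (-μ); linarith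
    _ = Real.exp (-(μ * L)) := by rw [← Real.exp_nat_mul]; ring_nf
    _ ≤ Real.exp (μ - μ * c' / 9 * Real.log n) := by
        rw [Real.exp_le_exp]
        have : μ * (c' * Real.log n) ≤ μ * (9 * L + 9) := mul_le_mul_of_nonneg_left hLge hμ0
        nlinarith
    _ = Real.exp μ * (n : ℝ) ^ (-(μ * c' / 9)) := by
        rw [Real.rpow_def_of_pos hn', ← Real.exp_add]; ring_nf

/-- `(∆+1)^L ≤ n^{1/36}` for `L = ⌊c' log n⌋/9` with `c' log(∆+2) ≤ 1/4`, `n ≥ 1`.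
[cite: CharikarMakarychevMakarychev2009, Thm 5.3 proof (p. 11: the ball around `T` has `≤ k∆^l` vertices)] -/
theorem pow_L_le {Δ : ℕ} {c' : ℝ} (hc' : 0 ≤ c') (hcΔ : c' * Real.log (Δ + 2) ≤ 1 / 4) {n : ℕ}
    (hn : 1 ≤ n) : ((Δ + 1 : ℕ) : ℝ) ^ (⌊c' * Real.log n⌋₊ / 9) ≤ (n : ℝ) ^ (1 / 36 : ℝ) := by
  set L := ⌊c' * Real.log n⌋₊ / 9 with hL
  have hn' : (0 : ℝ) < n := by exact_mod_cast hn
  have hlog : 0 ≤ Real.log n := Real.log_nonneg (by exact_mod_cast hn)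
  have hLle : (L : ℝ) ≤ c' * Real.log n / 9 := by
    have h1 : (⌊c' * Real.log n⌋₊ : ℝ) ≤ c' * Real.log n := Nat.floor_le (mul_nonneg hc' hlog)
    have h2 : 9 * L ≤ ⌊c' * Real.log n⌋₊ := by rw [hL]; omega
    have h3 : 9 * (L : ℝ) ≤ (⌊c' * Real.log n⌋₊ : ℝ) := by exact_mod_cast h2
    linarith
  have hΔ1 : (1 : ℝ) ≤ ((Δ + 1 : ℕ) : ℝ) := by exact_mod_cast Nat.le_add_left 1 Δ
  have hlogΔ : Real.log ((Δ + 1 : ℕ) : ℝ) ≤ Real.log (Δ + 2) := by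
    refine Real.log_le_log (by positivity) ?_
    push_cast; linarith
  have hlogΔ0 : 0 ≤ Real.log ((Δ + 1 : ℕ) : ℝ) := Real.log_nonneg hΔ1
  calc ((Δ + 1 : ℕ) : ℝ) ^ L = Real.exp (L * Real.log ((Δ + 1 : ℕ) : ℝ)) := by
        rw [← Real.rpow_natCast, Real.rpow_def_of_pos (by positivity)]; ring_nf
    _ ≤ Real.exp (Real.log n * (1 / 36)) := by
        rw [Real.exp_le_exp]
        calc (L : ℝ) * Real.log ((Δ + 1 : ℕ) : ℝ) ≤ (c' * Real.log n / 9) * Real.log (Δ + 2) :=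
              mul_le_mul hLle hlogΔ hlogΔ0 (by positivity)
          _ = Real.log n * (c' * Real.log (Δ + 2)) / 9 := by ring
          _ ≤ Real.log n * (1 / 4) / 9 := by gcongr
          _ = Real.log n * (1 / 36) := by ring
    _ = (n : ℝ) ^ (1 / 36 : ℝ) := by rw [Real.rpow_def_of_pos hn']

/-- **CMM09 Theorem 5.3 from the gap graphs.**  Everything else — Lemma 2.1, Thm 3.1 (Gram form),
Thm 5.2, Cor. 5.1, Thm 2.4 (= CMM10 Thm 3.3 with Lemma 3.4) — is proved in this directory.
[cite: CharikarMakarychevMakarychev2009, Thm 5.3 (p. 11)] -/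
theorem maxCutSA_of_gapGraphs (hX : CharikarMakarychevMakarychev2009_gapGraphs) :
    CharikarMakarychevMakarychev2009_maxCutSA := by
  intro ε hε
  -- parameters independent of `n`
  set ε₁ : ℝ := min (ε / 2) (1 / 2) with hε₁
  have hε₁0 : 0 < ε₁ := lt_min (by linarith) (by norm_num)
  have hε₁ε : ε₁ < ε := lt_of_le_of_lt (min_le_left _ _) (by linarith)
  have hε₁1 : ε₁ ≤ 1 / 2 := min_le_right _ _
  set μ : ℝ := ε₁ ^ 3 / 40 with hμ
  have hμ0 : 0 < μ := by rw [hμ]; positivity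
  have hμ1 : μ ≤ 1 := by
    rw [hμ]; have : ε₁ ^ 3 ≤ (1 / 2) ^ 3 := pow_le_pow_left₀ hε₁0.le hε₁1 3
    linarith
  have hμε : 40 * μ ≤ ε₁ ^ 3 := by rw [hμ]; linarith
  obtain ⟨Δ, c, hc, n₀, hgraphs⟩ := hX ε hε
  set c' : ℝ := min c (1 / (4 * Real.log (Δ + 2))) with hc'
  have hlog2 : 0 < Real.log ((Δ : ℝ) + 2) := Real.log_pos (by have := Nat.cast_nonneg (α := ℝ) Δ; linarith)
  have hc'0 : 0 < c' := lt_min hc (by positivity)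
  have hc'c : c' ≤ c := min_le_left _ _
  have hcΔ : c' * Real.log (Δ + 2) ≤ 1 / 4 := by
    have h1 : c' ≤ 1 / (4 * Real.log (Δ + 2)) := min_le_right _ _
    calc c' * Real.log (Δ + 2) ≤ 1 / (4 * Real.log (Δ + 2)) * Real.log (Δ + 2) :=
          mul_le_mul_of_nonneg_right h1 hlog2.le
      _ = 1 / 4 := by field_simp
  set γ : ℝ := μ * c' / 18 with hγ
  have hγ0 : 0 < γ := by rw [hγ]; positivity
  refine ⟨γ, hγ0, ?_⟩
  -- the conditions that hold for large `n`
  have ev1 : ∀ᶠ k : ℕ in atTop, n₀ ≤ k := eventually_ge_atTop n₀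
  have ev0 : ∀ᶠ k : ℕ in atTop, 1 ≤ k := eventually_ge_atTop 1
  have hpow : Tendsto (fun k : ℕ => (k : ℝ) ^ γ) atTop atTop :=
    (tendsto_rpow_atTop hγ0).comp tendsto_natCast_atTop_atTop
  have ev2 : ∀ᶠ k : ℕ in atTop, (2 : ℝ) ≤ (k : ℝ) ^ γ := hpow.eventually_ge_atTop 2
  have hdecay : Tendsto (fun k : ℕ => Real.exp μ * (k : ℝ) ^ (-γ)) atTop (𝓝 (Real.exp μ * 0)) :=
    ((tendsto_rpow_neg_atTop hγ0).comp tendsto_natCast_atTop_atTop).const_mul _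
  rw [mul_zero] at hdecay
  have ev3 : ∀ᶠ k : ℕ in atTop, Real.exp μ * (k : ℝ) ^ (-γ) < μ / 2 :=
    hdecay.eventually (gt_mem_nhds (by positivity))
  obtain ⟨n₁, hn₁⟩ := eventually_atTop.1 (ev1.and (ev0.and (ev2.and ev3)))
  refine ⟨n₁, fun n hn => ?_⟩
  obtain ⟨h₀, h1, h2, h3⟩ := hn₁ n hn
  obtain ⟨E, hE, hloop, hΔ, hs, hPD⟩ := hgraphs n h₀
  have hn' : (0 : ℝ) < n := by exact_mod_cast h1
  -- the `n`-dependent parameters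
  set L : ℕ := ⌊c' * Real.log n⌋₊ / 9 with hLdef
  set d : ℕ := ⌊(n : ℝ) ^ γ⌋₊ with hddef
  have hdle : (d : ℝ) ≤ (n : ℝ) ^ γ := Nat.floor_le (by positivity)
  have hd2 : 2 ≤ d := by rw [hddef]; exact Nat.le_floor (by exact_mod_cast h2)
  have h1μ : 0 ≤ 1 - μ := by linarith
  -- `η = (1−µ)^L ≤ e^µ n^{−2γ}` and `d η ≤ µ/2`
  have hηle : (1 - μ) ^ L ≤ Real.exp μ * (n : ℝ) ^ (-(μ * c' / 9)) :=
    one_sub_pow_L_le hμ0.le hμ1 h1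
  have h2γ : -(μ * c' / 9) = -γ + -γ := by rw [hγ]; ring
  have hdη : (d : ℝ) * (1 - μ) ^ L ≤ μ / 2 := by
    calc (d : ℝ) * (1 - μ) ^ L ≤ (n : ℝ) ^ γ * (Real.exp μ * (n : ℝ) ^ (-(μ * c' / 9))) :=
          mul_le_mul hdle hηle (pow_nonneg h1μ L) (by positivity)
      _ = Real.exp μ * (n : ℝ) ^ (-γ) := by
          rw [h2γ, Real.rpow_add hn', Real.rpow_neg hn'.le]
          have : (n : ℝ) ^ γ ≠ 0 := (Real.rpow_pos_of_pos hn' γ).ne'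
          field_simp
      _ ≤ μ / 2 := h3.le
  have hq : (1 - μ) ^ L ≤ 1 / 2 := by
    have : (1 - μ) ^ L ≤ (d : ℝ) * (1 - μ) ^ L := by
      have hd1 : (1 : ℝ) ≤ d := by exact_mod_cast (by omega : 1 ≤ d)
      nlinarith [pow_nonneg h1μ L]
    linarith
  -- the ball fits: `(d (∆+1)^L)² ≤ n`
  have hfit : ((d * (Δ + 1) ^ L : ℕ) : ℝ) ^ 2 ≤ n := by
    have hb : ((Δ + 1 : ℕ) : ℝ) ^ L ≤ (n : ℝ) ^ (1 / 36 : ℝ) := pow_L_le hc'0.le hcΔ h1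
    have hprod : ((d * (Δ + 1) ^ L : ℕ) : ℝ) ≤ (n : ℝ) ^ (γ + 1 / 36) := by
      push_cast
      rw [Real.rpow_add hn']
      exact mul_le_mul hdle (by exact_mod_cast hb) (by positivity) (by positivity)
    have hγsmall : 2 * (γ + 1 / 36) ≤ 1 := by
      have : γ ≤ 1 / 18 := by
        rw [hγ]
        have hc'1 : c' ≤ 1 := by
          have : c' * Real.log (Δ + 2) ≥ c' * Real.log 2 :=
            mul_le_mul_of_nonneg_left (Real.log_le_log (by norm_num)
              (by have := Nat.cast_nonneg (α := ℝ) Δ; linarith)) hc'0.le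
          have hl2 : Real.log 2 > 1 / 2 := by
            have := Real.log_two_gt_d9; linarith
          nlinarith
        nlinarith
      linarith
    calc ((d * (Δ + 1) ^ L : ℕ) : ℝ) ^ 2 ≤ ((n : ℝ) ^ (γ + 1 / 36)) ^ 2 :=
          pow_le_pow_left₀ (Nat.cast_nonneg _) hprod 2
      _ = (n : ℝ) ^ (2 * (γ + 1 / 36)) := by
          rw [← Real.rpow_natCast, ← Real.rpow_mul hn'.le]; ring_nf
      _ ≤ (n : ℝ) ^ (1 : ℝ) := Real.rpow_le_rpow_of_exponent_le (by exact_mod_cast h1) hγsmall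
      _ = n := Real.rpow_one _
  -- path decomposability at length `9L ≤ ⌊c log n⌋`
  have hl : 9 * L ≤ ⌊c * Real.log n⌋₊ := by
    have h9 : 9 * L ≤ ⌊c' * Real.log n⌋₊ := by rw [hLdef]; exact Nat.mul_div_le _ 9
    refine h9.trans (Nat.floor_le_floor ?_)
    exact mul_le_mul_of_nonneg_right hc'c (Real.log_nonneg (by exact_mod_cast h1))
  exact not_SAAchieves_maxCut_of_gapGraph E hE hloop hΔ hs hPD hμ0.le hμ1 hε₁0 hε₁ε hμε hq hl hd2
    hdη hfit

end Assembly

/-- **CMM09 Theorem 5.3, discharged**: the Sherali–Adams gap for MAX-CUT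
(`CharikarMakarychevMakarychev2009_maxCutSA`) holds unconditionally.
[cite: CharikarMakarychevMakarychev2009, Thm 5.3 (p. 11)] -/
theorem CharikarMakarychevMakarychev2009_maxCutSA_holds : CharikarMakarychevMakarychev2009_maxCutSA :=
  maxCutSA_of_gapGraphs CharikarMakarychevMakarychev2009_gapGraphs_holds

end Literature.Combinatorics.Optimization
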